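import Summits.BirchSwinnertonDyer.BirchSwinnertonDyer.Theorems.KolyvaginDepthDoorMSymbolCertKurihara
import HarnessLib

/-!
# Route `KolyvaginDepthDoor`, crux `KolyvaginDepthSupplyKN` (stmt-BirchSwinnertonDyer-22820) —
# DEPTH TABLE v27, KIT 4b/4: the Kurihara number on a certified line, inverses as a TABLE

Helper file of the lead prover of line `levelone` (kdd-p1 g31; `--supports stmt-BirchSwinnertonDyer-22820
--as helper`); it closes nothing and BSD is NOT proved by it.

Kit 4's `exists_kuriharaNumber_ne_zero` takes the inverse of `k` modulo `n` as the power `k^E mod n`; for the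
larger Kurihara levels (`n ≈ 10⁴`) the kernel's evaluation of thousands of `10⁵`-bit powers is what fills its
memory. `exists_kuriharaNumber_ne_zero_w` is the SAME theorem with an arbitrary inverse function `w : ℕ → ℕ`
(a data file supplies a table and checks `k · w(k) ≡ 1 (mod n)` in chunks: `bezout_chunk`).
-/

set_option linter.dupNamespace false

noncomputable section

open scoped MatrixGroups ModularForm
open CongruenceSubgroup
open Literature.NumberTheory.EllipticCurves Literature.NumberTheory.EllipticCurves.ModularForms

namespace Summit.BirchSwinnertonDyer.BirchSwinnertonDyer.Theorems.KolyvaginDepthDoor.MSymbolCert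

/-- A Bezout chunk `lo ≤ k < lo + len` from its Boolean check on `List.range' lo len`:
`gcd(k, n) ≠ 1 ∨ k · w(k) ≡ 1 (mod n)`. [folklore] -/
theorem bezout_chunk {n : ℕ} {w : ℕ → ℕ} {lo len : ℕ}
    (h : (List.range' lo len).all (fun k => (Nat.gcd k n != 1) || ((k * w k) % n == 1)) = true) :
    ∀ k, lo ≤ k → k < lo + len → Nat.Coprime k n → ((k : ℤ) * (w k : ℤ)) % n = 1 := by
  intro k h1 h2 hc
  simp only [List.all_eq_true, List.mem_range'_1, Bool.or_eq_true, bne_iff_ne, ne_eq, beq_iff_eq] at h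
  rcases h k ⟨h1, h2⟩ with h' | h'
  · exact absurd hc h'
  · have : (((k * w k % n : ℕ)) : ℤ) = 1 := by rw [h']; rfl
    rw [← this]; push_cast; rfl

section Kurihara

variable {N : ℕ} (f : CuspForm (Gamma0 N) 2) (p : ℕ) [hp : Fact p.Prime] (n : ℕ) [NeZero n]

/-- **Kit 4's `exists_kuriharaNumber_ne_zero` with a tabulated inverse `w`.** For a newform `f` of `W` at prime
level `N`, `p` odd with `W[p]` irreducible, `n` prime to `N`, `re [e i]_f = t φ(i)` for `i ≤ N`, an inverse table
`k · w(k) ≡ 1 (mod n)`, one `p`-adic unit value `S(a₀/n)`, admissible surjective logarithm tables and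
`kSum ≠ 0`: there is a surjective `ψ` with `kuriharaNumber f p n ψ ≠ 0`. [cite: Kim2022StructureSelmer, §1.4.3] -/
theorem exists_kuriharaNumber_ne_zero_w [Fact N.Prime] {W : WeierstrassCurve ℚ} [W.IsElliptic]
    [W.IsGloballyMinimal] (hf : IsNewformOf W f) (hp2 : p ≠ 2) (hirr : W.HasIrreducibleModPGaloisRep p)
    (hnN : n.Coprime N) {φ : ℕ → ℤ} {t : ℝ} (hΨ : ∀ i ≤ N, Ψ f i = t * φ i)
    (w : ℕ → ℕ) (fuel : ℕ) (hfuel : n < fuel)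
    (hw : ∀ k < n, Nat.Coprime k n → ((k : ℤ) * (w k : ℤ)) % n = 1)
    (a₀ : ℕ) (ha₀ : a₀ < n) (ha₀c : Nat.Coprime a₀ n)
    (hunit : ¬ (p : ℤ) ∣ chainSum N φ fuel n (w a₀ : ℤ))
    (T : ℕ → List ℕ) (hT : ∀ ℓ, T ℓ = [] ∨ (ℓ.Prime ∧ tabOK ℓ p (T ℓ) = true))
    (hsurj : ∀ ℓ ∈ n.primeFactors, tabSurj ℓ p (T ℓ) = true)
    (hK : kSum p n (fun k => chainSum N φ fuel n (w k : ℤ)) n.primeFactors T ≠ 0) :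
    ∃ ψ : (ℓ : ℕ) → (ZMod ℓ)ˣ →* Multiplicative (ZMod p),
      (∀ ℓ ∈ n.primeFactors, Function.Surjective (ψ ℓ)) ∧ kuriharaNumber f p n ψ ≠ 0 := by
  have hf0 : IsNewform0 f := hf.1
  have hQ : coeffField f = ⊥ := hf.coeffField_eq_bot
  obtain ⟨g, ε, hg, hε, hval⟩ := exists_ratPlusSymbol_eq f hf0 hQ hΨ
  have hn : 0 < n := Nat.pos_of_ne_zero (NeZero.ne n)
  have hsym : ∀ k < n, Nat.Coprime k n →
      ratPlusSymbol f ((k : ℚ) / n) = ε * chainSum N φ fuel n (w k : ℤ) / (2 * g) := by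
    intro k hk hkc
    have := hval k (w k : ℤ) n hn (hw k hk hkc) fuel hfuel
    rwa [Int.cast_natCast] at this
  have h2g : ¬ p ∣ 2 * g := by
    have hle : ‖((ratPlusSymbol f ((a₀ : ℚ) / n) : ℚ) : ℚ_[p])‖ ≤ 1 := by
      refine IsNewformOf.norm_ratPlusSymbol_le_one hf hp2 hirr ?_
      have hden : (((a₀ : ℚ) / n).den : ℤ) ∣ (n : ℤ) := by
        have := Rat.den_dvd (a₀ : ℤ) (n : ℤ)
        rwa [Rat.divInt_eq_div, Int.cast_natCast, Int.cast_natCast] at this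
      have hden' : ((a₀ : ℚ) / n).den ∣ n := by exact_mod_cast hden
      exact Nat.Coprime.coprime_dvd_left hden' hnN
    rw [hsym a₀ ha₀ ha₀c] at hle
    have := not_dvd_of_norm_div_le_one p ε _ (2 * g) (by omega) hε hunit (by push_cast at hle ⊢; exact hle)
    exact this
  refine ⟨tabFamily p T hT, fun ℓ hℓ => surjective_tabFamily p T hT (Nat.prime_of_mem_primeFactors hℓ) (hsurj ℓ hℓ), ?_⟩
  rw [kuriharaNumber_eq_unit_mul_kSum f p n T hT _ ε g h2g hsym]
  refine mul_ne_zero (div_ne_zero ?_ ?_) hK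
  · rcases hε with rfl | rfl
    · simp
    · simp only [Int.reduceNeg, Int.cast_neg, Int.cast_one, ne_eq, neg_eq_zero]
      exact one_ne_zero
  · rw [ne_eq, ZMod.natCast_eq_zero_iff]; exact h2g

end Kurihara

end Summit.BirchSwinnertonDyer.BirchSwinnertonDyer.Theorems.KolyvaginDepthDoor.MSymbolCert

end
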